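import Summits.CriticalPhenomena.CardyFormulaZ2.Theorems.CardyMagicRigidityLoopsToCrossingsStubDiscreteCrossingOfPathIn
import HarnessLib

/-!
# Stub `stub_domainContinuity` (S2), part 2: the bond port of Claim 19 with an explicit plate margin

Crux `Summit.CriticalPhenomena.CardyFormulaZ2.Theses.CardyWickAnisotropy.BoxFamilyToCardy`
(stmt-CriticalPhenomena-14215), line `registered`, stub `stub_domainContinuity` (shared verbatim
with stmt-CriticalPhenomena-0794).

The tree's bond port `OracleSandwich.stub_discreteCrossing_of_pathIn` (Bollobás–Riordan, Ch. 7,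
Claim 19 on `δℤ²`: an open `ℤ²`-path poking out of `Ω̄` across the arcs `0, 2` and keeping one
mesh off the arcs `1, 3` contains a G02 crossing of `Ω_δ`) hides its plate margin `t₀(R)` behind
an existential, whereas its proof takes `t₀ = ε/8` for ANY `ε` below the distance between
`R.arc 0` and `R.arc 2`. The cross-domain squeeze of S2 needs this margin bounded below
uniformly over all conformal rectangles `Q` close to a fixed `R` (their arcs `0, 2` stay
`ε_R/2` apart), so this file re-proves the port with the margin made EXPLICIT:
`discreteCrossing_of_pathIn_explicit` — same proof, verbatim (`PathIn.exists_run`,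
`exists_mem_dist_le_of_nearOut_z2`, `mem_discreteArc_of_dist_le_z2`, and the bulk theorem
`JordanDomain.exists_mem_meshDomain_of_reachable`, which supplies the only mesh threshold
`δ₀(R, ε)` left existential).

References: B. Bollobás, O. Riordan, *Percolation* (2006), Ch. 7, Claim 19 p. 192, remark
p. 195; S. Smirnov, C. R. Acad. Sci. Paris 333 (2001), §2.
-/

noncomputable section

namespace Summit.CriticalPhenomena.CardyFormulaZ2.Cruxes.BoxFamilyToCardy.Birth

open Literature.Probability.RandomPlanarGeometry hiding cardyFunction
open Literature.Probability.Percolation hiding cardyFunction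
open Literature.Probability.LatticeModels
open Summit.CriticalPhenomena.CardyFormulaZ2.Cruxes.LoopsToCrossings.OracleSandwich
open Filter Topology Set MeasureTheory Metric

/-- **Bond port of the lower half of the Bollobás–Riordan sandwich, explicit plate margin.** Let
`R` be a conformal rectangle and `ε > 0` a strict lower bound for the distance between `R.arc 0`
and `R.arc 2`. There is `δ₀ > 0` such that for `0 < δ < δ₀` and `0 ≤ t ≤ ε/8`: an open
`ℤ²`-path inside a site set `S` whose off-`Ω` sites are `t`-close to `arc 0 ∪ arc 2` and whose
in-`Ω` sites keep one mesh off `arc 1 ∪ arc 3`, from an off-`Ω` site near `arc 0` to an off-`Ω`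
site near `arc 2`, contains a G02 crossing of `Ω_δ` (largest mesh component, discrete arcs):
between the last step near `arc 0` and the first later step near `arc 2` lies a run of open
inside steps (`PathIn.exists_run`), whose ends are boundary vertices on the discrete arcs of
`arc 0`, `arc 2` (`exists_mem_dist_le_of_nearOut_z2`, `mem_discreteArc_of_dist_le_z2`) and which
is long (`≥ ε/2`), hence in the bulk (`JordanDomain.exists_mem_meshDomain_of_reachable`). This
is `OracleSandwich.stub_discreteCrossing_of_pathIn` with its margin `t₀ = ε/8` exposed.
[cite: BollobasRiordan2006, Ch. 7 Claim 19 p. 192 and remark p. 195] -/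
theorem discreteCrossing_of_pathIn_explicit :
    ∀ (R : Literature.Probability.RandomPlanarGeometry.ConformalRectangle) (ε : ℝ), 0 < ε → (∀ a ∈ R.arc 0, ∀ b ∈ R.arc 2, ε < dist a b) → ∃ δ₀ : ℝ, 0 < δ₀ ∧ ∀ δ t : ℝ, 0 < δ → δ < δ₀ → 0 ≤ t → t ≤ ε / 8 → ∀ (ω : Literature.Probability.Percolation.BondConfig (Literature.Probability.LatticeModels.Site 2)) (S : Set (Literature.Probability.LatticeModels.Site 2)) (u v : Literature.Probability.LatticeModels.Site 2), (∀ x ∈ S, Literature.Probability.LatticeModels.meshPoint δ x ∉ R.carrier → Metric.infDist (Literature.Probability.LatticeModels.meshPoint δ x) (R.arc 0) ≤ t ∨ Metric.infDist (Literature.Probability.LatticeModels.meshPoint δ x) (R.arc 2) ≤ t) → (∀ x ∈ S, Literature.Probability.LatticeModels.meshPoint δ x ∈ R.carrier → δ < Metric.infDist (Literature.Probability.LatticeModels.meshPoint δ x) (R.arc 1) ∧ δ < Metric.infDist (Literature.Probability.LatticeModels.meshPoint δ x) (R.arc 3)) → Literature.Probability.LatticeModels.meshPoint δ u ∉ R.carrier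 → Metric.infDist (Literature.Probability.LatticeModels.meshPoint δ u) (R.arc 0) ≤ t → Literature.Probability.LatticeModels.meshPoint δ v ∉ R.carrier → Metric.infDist (Literature.Probability.LatticeModels.meshPoint δ v) (R.arc 2) ≤ t → Literature.Probability.Percolation.PathIn (Literature.Probability.Percolation.openGraph ω ⊓ Literature.Probability.LatticeModels.zdGraph 2) S u v → ω ∈ Literature.Probability.Percolation.discreteCrossing R.carrier δ (R.arc 0) (R.arc 2) := by
  intro R ε hε hεd
  obtain ⟨δ₁, hδ₁, hBC⟩ :=
    R.toJordanDomain.exists_mem_meshDomain_of_reachable (d₀ := ε / 2) (by positivity)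
  refine ⟨min δ₁ (ε / 8), by positivity, ?_⟩
  intro δ t hδ hδlt ht htle ω S u v hout hin huΩ huA hvΩ hvB hP
  have hδδ₁ : δ < δ₁ := hδlt.trans_le (min_le_left _ _)
  have hδε : δ < ε / 8 := hδlt.trans_le (min_le_right _ _)
  set Ω := R.carrier with hΩ
  set A := R.arc 0 with hA
  set B := R.arc 2 with hB
  have hΩo : IsOpen Ω := R.isOpen
  have hfr : frontier Ω ⊆ (A ∪ B) ∪ (R.arc 1 ∪ R.arc 3) := frontier_subset_arcs_zero_two R
  have hfr' : frontier Ω ⊆ (B ∪ A) ∪ (R.arc 1 ∪ R.arc 3) := hfr.trans (by rw [union_comm A B])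
  have hAne : A.Nonempty := ⟨_, R.pt_mem_arc_self 0⟩
  have hBne : B.Nonempty := ⟨_, R.pt_mem_arc_self 2⟩
  have hAB : ∀ p ∈ A, ∀ q ∈ B, 2 * t + 2 * δ < dist p q := fun p hp q hq => by
    linarith [hεd p hp q hq]
  have hBA : ∀ p ∈ B, ∀ q ∈ A, 2 * t + 2 * δ < dist p q := fun p hp q hq => by
    rw [dist_comm]; exact hAB q hq p hp
  -- the inside graph: open mesh edges with both end-points in `Ω`
  obtain ⟨H, hH⟩ : ∃ H : SimpleGraph (Site 2), H = (openGraph ω ⊓ zdGraph 2) ⊓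
      SimpleGraph.fromRel (fun x y : Site 2 =>
        (meshGraph Ω δ).Adj x y ∧ meshPoint δ x ∈ Ω ∧ meshPoint δ y ∈ Ω) := ⟨_, rfl⟩
  have hHadj : ∀ x y, H.Adj x y ↔ (openGraph ω ⊓ zdGraph 2).Adj x y ∧
      (meshGraph Ω δ).Adj x y ∧ meshPoint δ x ∈ Ω ∧ meshPoint δ y ∈ Ω := by
    intro x y
    rw [hH, SimpleGraph.inf_adj, SimpleGraph.fromRel_adj]
    constructor
    · rintro ⟨hG, -, h | h⟩
      · exact ⟨hG, h⟩
      · exact ⟨hG, h.1.symm, h.2.2, h.2.1⟩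
    · rintro ⟨hG, h⟩
      exact ⟨hG, hG.ne, Or.inl h⟩
  have hHG : H ≤ openGraph ω ⊓ zdGraph 2 := fun x y h => ((hHadj x y).1 h).1
  -- the three kinds of steps
  have hclass : ∀ a ∈ S, ∀ b ∈ S, (openGraph ω ⊓ zdGraph 2).Adj a b →
      H.Adj a b ∨
        (∃ z ∈ segment ℝ (meshPoint δ a) (meshPoint δ b), z ∉ Ω ∧ infDist z A ≤ t) ∨
        (∃ z ∈ segment ℝ (meshPoint δ a) (meshPoint δ b), z ∉ Ω ∧ infDist z B ≤ t) := by
    intro a haS b _ hab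
    have hab' : (zdGraph 2).Adj a b := ((SimpleGraph.inf_adj _ _ _ _).1 hab).2
    rcases segment_subset_or_nearOut_z2 hΩo hfr hδ ht hab' (hout a haS) (hin a haS)
      with h | h | h
    · refine Or.inl ((hHadj a b).2 ⟨hab, ?_, h (left_mem_segment ℝ _ _),
        h (right_mem_segment ℝ _ _)⟩)
      exact meshGraph_adj_iff.2 ⟨hab', h.trans subset_closure⟩
    · exact Or.inr (Or.inl h)
    · exact Or.inr (Or.inr h)
  have hu' : ∀ b ∈ S, (openGraph ω ⊓ zdGraph 2).Adj u b → ¬ H.Adj u b ∧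
      (∃ z ∈ segment ℝ (meshPoint δ u) (meshPoint δ b), z ∉ Ω ∧ infDist z A ≤ t) :=
    fun b _ _ => ⟨fun h => huΩ ((hHadj u b).1 h).2.2.1, _, left_mem_segment ℝ _ _, huΩ, huA⟩
  have hv' : ∀ a ∈ S, (openGraph ω ⊓ zdGraph 2).Adj a v → ¬ H.Adj a v ∧
      ¬ (∃ z ∈ segment ℝ (meshPoint δ a) (meshPoint δ v), z ∉ Ω ∧ infDist z A ≤ t) :=
    fun a _ hav => ⟨fun h => hvΩ ((hHadj a v).1 h).2.2.2,
      fun h => not_nearOut_z2 hδ hAne hBne hAB ((SimpleGraph.inf_adj _ _ _ _).1 hav).2 h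
        (nearOut_symm_z2 ⟨_, left_mem_segment ℝ _ _, hvΩ, hvB⟩)⟩
  have huv : u ≠ v := by
    rintro rfl
    obtain ⟨p, hp, hup⟩ := (infDist_lt_iff hAne).1
      (show infDist (meshPoint δ u) A < t + δ by linarith)
    obtain ⟨q, hq, huq⟩ := (infDist_lt_iff hBne).1
      (show infDist (meshPoint δ u) B < t + δ by linarith)
    linarith [hAB p hp q hq, dist_triangle p (meshPoint δ u) q, dist_comm p (meshPoint δ u)]
  obtain ⟨a', a, b, b', -, ha'a, hnH, hL0, hrun, -, hbb', hnHb, hnL0, hL2⟩ :=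
    PathIn.exists_run (H := H) hHG hclass hu' hv' huv hP
  have haS : a ∈ S := hrun.left_mem
  have hbS : b ∈ S := hrun.right_mem
  have ha'azd : (zdGraph 2).Adj a' a := ((SimpleGraph.inf_adj _ _ _ _).1 ha'a).2
  have hbb'zd : (zdGraph 2).Adj b b' := ((SimpleGraph.inf_adj _ _ _ _).1 hbb').2
  -- the ends of the run are inside `Ω`
  have haΩ : meshPoint δ a ∈ Ω := by
    by_contra h
    rcases hout a haS h with h' | h'
    · by_cases hab : a = b
      · subst hab
        exact hnL0 ⟨_, left_mem_segment ℝ _ _, h, h'⟩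
      · obtain ⟨c, -, hac⟩ := hrun.exists_adj_head hab
        exact h ((hHadj a c).1 hac).2.2.1
    · exact not_nearOut_z2 hδ hAne hBne hAB ha'azd hL0
        (nearOut_symm_z2 ⟨_, left_mem_segment ℝ _ _, h, h'⟩)
  have hbΩ : meshPoint δ b ∈ Ω := by
    by_contra h
    rcases hout b hbS h with h' | h'
    · exact hnL0 ⟨_, left_mem_segment ℝ _ _, h, h'⟩
    · by_cases hab : a = b
      · subst hab
        exact not_nearOut_z2 hδ hAne hBne hAB ha'azd hL0
          (nearOut_symm_z2 ⟨_, left_mem_segment ℝ _ _, h, h'⟩)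
      · obtain ⟨c, -, hcb⟩ := hrun.exists_adj_last hab
        exact h ((hHadj c b).1 hcb).2.2.2
  -- the exits at the two ends
  obtain ⟨fa, hfaA, hafa⟩ :=
    exists_mem_dist_le_of_nearOut_z2 hΩo hfr hAne hδ hAB ha'azd hL0 haΩ (hin a haS haΩ)
  obtain ⟨fb, hfbB, hbfb⟩ :=
    exists_mem_dist_le_of_nearOut_z2 hΩo hfr' hBne hδ hBA hbb'zd.symm (nearOut_symm_z2 hL2) hbΩ
      (hin b hbS hbΩ)
  -- the run is long, hence in the bulk
  have hfar : ε / 2 ≤ dist (meshPoint δ a) (meshPoint δ b) := by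
    have := hεd fa hfaA fb hfbB
    linarith [dist_triangle4 fa (meshPoint δ a) (meshPoint δ b) fb, dist_comm fa (meshPoint δ a)]
  have hHmesh : ∀ p q, H.Adj p q → (meshGraph Ω δ).Adj p q ∧ meshPoint δ q ∈ Ω := fun p q h =>
    ⟨((hHadj p q).1 h).2.1, ((hHadj p q).1 h).2.2.2⟩
  obtain ⟨hbΩ', hreach⟩ := reachable_meshVertexGraph_of_pathIn_z2 hHmesh hrun haΩ
  have haD : a ∈ meshDomain Ω δ := hBC δ hδ hδδ₁ ⟨a, haΩ⟩ ⟨b, hbΩ'⟩ hreach hfar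
  have hrun' : PathIn H (meshDomain Ω δ ∩ S) a b :=
    pathIn_inter_of_invariant_z2 hrun haD fun p _ q _ hpD hpq =>
      mem_meshDomain_of_meshGraph_adj hpD ((hHadj p q).1 hpq).2.2.2 ((hHadj p q).1 hpq).2.1
  have hbD : b ∈ meshDomain Ω δ := hrun'.right_mem.1
  have hpath : PathIn (openGraph ω ⊓ discreteDomainGraph Ω δ) (meshDomain Ω δ ∩ S) a b :=
    hrun'.mono_of_adj (fun p hp q hq hpq => (SimpleGraph.inf_adj _ _ _ _).2
      ⟨((SimpleGraph.inf_adj _ _ _ _).1 ((hHadj p q).1 hpq).1).1,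
        discreteDomainGraph_adj_iff.2 ⟨((hHadj p q).1 hpq).2.1, hp.1, hq.1⟩⟩) (fun _ hp => hp)
  -- the ends are boundary vertices on the right discrete arcs
  have hbdry : ∀ {p p' : Site 2}, p ∈ meshDomain Ω δ → meshPoint δ p ∈ Ω →
      (openGraph ω ⊓ zdGraph 2).Adj p' p → ¬ H.Adj p' p → p ∈ meshBoundary Ω δ := by
    intro p p' hpD hpΩ hp'p hnH
    refine ⟨hpD, p', ((SimpleGraph.inf_adj _ _ _ _).1 hp'p).2.symm, fun hadj => hnH ?_⟩
    obtain ⟨hmesh, -, hp'D⟩ := discreteDomainGraph_adj_iff.1 hadj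
    exact (hHadj p' p).2 ⟨hp'p, hmesh.symm, meshDomain_subset_meshVertices Ω δ hp'D, hpΩ⟩
  have hdisj := R.disjoint_arc_zero_arc_two
  have hneA : (frontier Ω \ A).Nonempty :=
    ⟨R.pt 2, R.arc_subset_frontier 2 (R.pt_mem_arc_self 2),
      fun h => Set.disjoint_left.1 hdisj h (R.pt_mem_arc_self 2)⟩
  have hneB : (frontier Ω \ B).Nonempty :=
    ⟨R.pt 0, R.arc_subset_frontier 0 (R.pt_mem_arc_self 0),
      fun h => Set.disjoint_left.1 hdisj (R.pt_mem_arc_self 0) h⟩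
  have haB : a ∈ meshBoundary Ω δ := hbdry haD haΩ ha'a hnH
  have hbB' : b ∈ meshBoundary Ω δ := hbdry hbD hbΩ hbb'.symm (fun h => hnHb h.symm)
  have haArc : a ∈ discreteArc Ω δ A :=
    mem_discreteArc_of_dist_le_z2 R hAB ht hfr hneA haB hfaA hafa (hin a haS haΩ)
  have hbArc : b ∈ discreteArc Ω δ B :=
    mem_discreteArc_of_dist_le_z2 R hBA ht hfr' hneB hbB' hfbB hbfb (hin b hbS hbΩ)
  exact mem_discreteCrossing_iff.2 ⟨a, haArc, b, hbArc, DCT16.reachable_of_pathIn hpath⟩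

end Summit.CriticalPhenomena.CardyFormulaZ2.Cruxes.BoxFamilyToCardy.Birth

end
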